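import Summits.Parity.BatemanHorn.Theorems.SoloBlindAlignmentQuadratic

/-!
# Many sign patterns defeat the bilinear form (solo-blind programme, session 8)

A counting ("Markov") supplement to `SoloBlindAlignmentGeneral`: there, for an injective `v`, edge
structure `N` with fibres of size `≤ D` and cofactor set `⊆ M`, the SUM over all `2^{#M}` sign patterns
`ξ = sgn_U` of the aligned bilinear form `B(ξ, κ(ξ))` is at least `2^{#M} E / D`
(`edgeCount_mul_pow_le_sum_bilin`).  Since each single `B(ξ, κ(ξ))` is at most the edge count `E`
(`bilin_sgn_aligned_le_edgeCount`, from `|B| ≤ T ≤ E`), at least a proportion `1/(2D)` of ALL sign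
patterns satisfies `B(ξ, κ(ξ)) ≥ E/(2D)` (`card_good_patterns`): the failure of a free-coefficient
bilinear ("Type II") bound is not a single adversarial coefficient but a positive proportion of the
hypercube `{±1}^M` — the form in which the paper (Theorem 10.1′(c),(e)) combines it with a first-moment
bound for the smooth comparison term.

* `markov_card` — the abstract counting lemma: if `B_U ≤ E` on `P` and `#P · E ≤ D · ∑_{U ∈ P} B_U` with
  `E > 0`, `D ≥ 0`, then `#P ≤ 2D · #{U ∈ P : E ≤ 2D · B_U}`;
* `card_good_patterns` — the instance for the aligned bilinear form over `M.powerset`.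

Mathlib only (through the imported framework files); no `sorry`.
-/

open Finset

namespace Summit.Parity.BatemanHorn.Theorems.SoloBlindAlignmentMarkov

open Summit.Parity.BatemanHorn.Theorems.SoloBlindAlignmentGeneral
open Summit.Parity.BatemanHorn.Theorems.SoloBlindAlignmentQuadratic

/-- **Markov counting.** If every `B_U ≤ E` (`U ∈ P`), `E > 0`, `D ≥ 0` and `#P · E ≤ D · ∑_{U ∈ P} B_U`,
then at least `#P/(2D)` elements of `P` have `2D · B_U ≥ E`. -/
theorem markov_card {ι : Type*} (P : Finset ι) (B : ι → ℤ) {E D : ℤ} (hE : 0 < E) (hD : 0 ≤ D)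
    (hB : ∀ U ∈ P, B U ≤ E) (hsum : (P.card : ℤ) * E ≤ D * ∑ U ∈ P, B U) :
    (P.card : ℤ) ≤ 2 * D * ((P.filter fun U => E ≤ 2 * D * B U).card : ℤ) := by
  classical
  have hsplit := Finset.sum_filter_add_sum_filter_not P (fun U => E ≤ 2 * D * B U) B
  have hG : ∑ U ∈ P.filter (fun U => E ≤ 2 * D * B U), B U
      ≤ ((P.filter fun U => E ≤ 2 * D * B U).card : ℤ) * E := by
    have h := Finset.sum_le_sum fun U (hU : U ∈ P.filter (fun U => E ≤ 2 * D * B U)) =>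
      hB U (Finset.mem_filter.mp hU).1
    rwa [Finset.sum_const, nsmul_eq_mul] at h
  have hbad : 2 * D * ∑ U ∈ P.filter (fun U => ¬ E ≤ 2 * D * B U), B U ≤ (P.card : ℤ) * E := by
    rw [Finset.mul_sum]
    have h := Finset.sum_le_sum fun U (hU : U ∈ P.filter (fun U => ¬ E ≤ 2 * D * B U)) =>
      (show 2 * D * B U ≤ E from (not_le.mp (Finset.mem_filter.mp hU).2).le)
    refine h.trans ?_
    rw [Finset.sum_const, nsmul_eq_mul]
    have hc : ((P.filter fun U => ¬ E ≤ 2 * D * B U).card : ℤ) ≤ P.card := by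
      exact_mod_cast Finset.card_filter_le P _
    nlinarith
  have hG2 := mul_le_mul_of_nonneg_left hG (by positivity : (0 : ℤ) ≤ 2 * D)
  have hsplitD : 2 * D * ∑ U ∈ P, B U
      = 2 * D * ∑ U ∈ P.filter (fun U => E ≤ 2 * D * B U), B U
        + 2 * D * ∑ U ∈ P.filter (fun U => ¬ E ≤ 2 * D * B U), B U := by
    rw [← hsplit]; ring
  have h3 : (P.card : ℤ) * E ≤ (2 * D * ((P.filter fun U => E ≤ 2 * D * B U).card : ℤ)) * E := by
    nlinarith [hsplitD, hG2, hbad, hsum]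
  exact le_of_mul_le_mul_right h3 hE

/-- Every single pattern has `B(sgn_U, κ(sgn_U)) ≤ E` (from `B ≤ |B| ≤ T ≤ E`). -/
theorem bilin_sgn_aligned_le_edgeCount (x : ℕ) (v : ℕ → ℕ) (N : ℕ → Finset ℕ) (U : Finset ℕ) :
    bilin x v N (sgn U) (aligned x v N (sgn U)) ≤ (edgeCount x N : ℤ) :=
  (le_abs_self _).trans ((abs_bilin_le_trivialBound x v N _ _).trans
    (trivialBound_le_edgeCount x v N (fun m => (abs_sgn U m).le) (abs_aligned_le_one x v N _)))

/-- `B(ξ, κ(ξ)) ≥ 0` for every `ξ`. -/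
theorem bilin_aligned_nonneg (x : ℕ) (v : ℕ → ℕ) (N : ℕ → Finset ℕ) (ξ : ℕ → ℤ) :
    0 ≤ bilin x v N ξ (aligned x v N ξ) := by
  rw [bilin_aligned_eq_sum_abs]
  exact Finset.sum_nonneg fun n _ => abs_nonneg _

/-- **A positive proportion of sign patterns defeats the bilinear form.** Under the hypotheses of
`edgeCount_mul_pow_le_sum_bilin` (injective `v`, `n ∣ v(k)` on edges, cofactors in `M`, fibres of size
`≤ D`) and `E > 0`: at least `2^{#M}/(2D)` of the `2^{#M}` patterns `U ⊆ M` satisfy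
`2D · B(sgn_U, κ(sgn_U)) ≥ E`. -/
theorem card_good_patterns (x D : ℕ) {v : ℕ → ℕ} {N : ℕ → Finset ℕ} {M : Finset ℕ}
    (hv : Set.InjOn v ↑(range (x + 1))) (hdvd : ∀ k ∈ range (x + 1), ∀ n ∈ N k, n ∣ v k)
    (hM : ∀ k ∈ range (x + 1), ∀ n ∈ N k, v k / n ∈ M)
    (hD : ∀ n ∈ moduli x N, (fibre x N n).card ≤ D) (hE : 0 < edgeCount x N) :
    (2 : ℤ) ^ M.card ≤ 2 * (D : ℤ) * ((M.powerset.filter fun U =>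
        (edgeCount x N : ℤ) ≤ 2 * (D : ℤ) * bilin x v N (sgn U) (aligned x v N (sgn U))).card : ℤ) := by
  have h1 := edgeCount_mul_pow_le_sum_bilin x D hv hdvd hM hD
  have hP : ((M.powerset).card : ℤ) = (2 : ℤ) ^ M.card := by
    rw [Finset.card_powerset]; push_cast; rfl
  have h := markov_card M.powerset (fun U => bilin x v N (sgn U) (aligned x v N (sgn U)))
    (E := (edgeCount x N : ℤ)) (D := (D : ℤ)) (by exact_mod_cast hE) (by positivity)
    (fun U _ => bilin_sgn_aligned_le_edgeCount x v N U) (by rw [hP]; exact h1)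
  rw [hP] at h
  exact h

end Summit.Parity.BatemanHorn.Theorems.SoloBlindAlignmentMarkov
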